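import Summits.HodgeConjecture.HodgeConjecture.Theorems.GenericDivisibilityGenericDivisibilityBoundedBirationalUp
import Summits.HodgeConjecture.HodgeConjecture.Theorems.GenericDivisibilityGenericDivisibilityBoundedHeartStructure
import HarnessLib

/-!
# The `N¹ = ⊤` sector of crux C2 (stmt-HodgeConjecture-18467) ASCENDS along birational morphisms:
# `supportedClasses X k 1 = ⊤` is a birational invariant of smooth projective varieties

Line `finite-level-bootstrap`, registered sub-goal `stub_supportedTopOfBirationalUp` (lead c5).
Sorry-free, definition-free. `σ : X' ⟶ X` is a `ℂ`-morphism of smooth projective `n`-folds with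
`σ.left` birational (an isomorphism over a dense open `U ⊆ X`), `σ(ℂ) = AlgPoints.mapContinuous σ`,
`H = H^k(–(ℂ); ℂ) = complexBetti`, `N¹ = supportedClasses _ k 1` (classes dying on the complex
points of a non-empty Zariski open). The sector `𝒮 = {X : N¹H^k(X) = H^k(X)}` is the one where the
crux C2 and the heart of the line are already theorems (the landed `…SupportedTop`); the landed
`genericDivisibilityBounded_supportedClasses_eq_top_of_surjective` (`…HeartStructure`) shows that
`𝒮` DESCENDS along surjective morphisms of smooth projective `n`-folds. This file proves that `𝒮`
ASCENDS along birational ones, so that **`N¹H^k = H^k` is a birational invariant of smooth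
projective varieties**.

## The argument (Voisin I, Lemma 7.28 and proof of Thm. 7.31, first step)

Fix `ℂ`-orientations `μ`, `ν` of `X'(ℂ)`, `X(ℂ)` with `σ(ℂ)_*[X'] = [X]`
(`exists_hasDegree_one_of_isBirational`, Fulton Lemma 19.1.2), and let `σ_! = gysinMap μ ν σ(ℂ)` be
the complex Gysin map, so `σ_! σ^* = id` (`gysinMap_map_of_hasDegree`). For `x'` on `X'` put
`y = σ_! x'` and `w = x' - σ^* y`; then `σ_! w = y - y = 0`, so `w` dies on `(σ⁻¹U)(ℂ)`
(`genericDivisibilityBounded_restrictCompl_eq_zero_of_gysinMap_eq_zero`, Voisin I proof of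
Thm. 7.31), i.e. `w ∈ N¹H^k(X')` (`σ⁻¹(X ∖ U)` is a proper closed subset of the integral `X'`).
Hence **every class on `X'` is a pull-back from `X` modulo `N¹`**
(`genericDivisibilityBounded_exists_sub_map_mem_supportedClasses_of_isBirational`). If now
`N¹H^k(X) = H^k(X)` then `σ^* y ∈ N¹H^k(X')` — pull-back along the SURJECTIVE (proper birational)
`σ` preserves `N¹` (`map_mem_supportedClasses_one_of_surjective`) — and `x' = w + σ^* y ∈ N¹`.

## Main results

* `genericDivisibilityBounded_exists_sub_map_mem_supportedClasses_of_isBirational` —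
  `∀ x', ∃ y, x' - σ^* y ∈ N¹H^k(X')` for `σ` birational;
* `genericDivisibilityBounded_supportedClasses_eq_top_of_isBirational_up` — **`N¹H^k(X) = H^k(X)`
  implies `N¹H^k(X') = H^k(X')`** for `σ : X' ⟶ X` birational between smooth projective `n`-folds,
  `k + q = 2n`; `…_supportedClasses_eq_top_iff_of_isBirational` — with the landed descent,
  `N¹ = ⊤` is a birational invariant;
* `stub_supportedTopOfBirationalUp` — the registered signature, verbatim.

References: [VoisinHodgeI2002] §7.3.2 Lemma 7.28, Remark 7.29, proof of Thm. 7.31; [Fulton1998]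
Lemma 19.1.2; [FultonYoungTableaux1997] App. B §B.2 Exercise 5; [GrothendieckTopology1969] §1;
[SGA1] XII Prop. 3.1 (xi).
-/

set_option linter.dupNamespace false

noncomputable section

namespace Summit.HodgeConjecture.HodgeConjecture.Theorems

open CategoryTheory AlgebraicGeometry
open Literature.AlgebraicGeometry.Motives Literature.AlgebraicGeometry.HodgeTheory
  Literature.AlgebraicTopology.SingularHomology

variable {n : ℕ} {X' X : SchemeOver ℂ}

/-! ### Every class on `X'` is a pull-back from `X` modulo `N¹` -/

/-- **Modulo `N¹`, every complex class on `X'` is pulled back from `X` along a birational `σ`.**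
For `σ : X' ⟶ X` birational between smooth projective `n`-folds, `k + q = 2n`, and
`x' ∈ H^k(X'(ℂ);ℂ)`: with `ℂ`-orientations of degree one (`exists_hasDegree_one_of_isBirational`,
Fulton Lemma 19.1.2), `y = σ_! x'` and `w = x' - σ^* y` one has `σ_! w = 0` (`σ_! σ^* = id`,
`gysinMap_map_of_hasDegree`), so `w` dies on the complex points of the iso locus `σ⁻¹U`
(`genericDivisibilityBounded_restrictCompl_eq_zero_of_gysinMap_eq_zero`, Voisin I proof of
Thm. 7.31, first step), a non-empty open of the integral `X'`; hence `w ∈ N¹H^k(X'(ℂ);ℂ)`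
(`mem_supportedClasses_of_restrictCompl_eq_zero`).
[cite: VoisinHodgeI2002, §7.3.2 Lemma 7.28 and proof of Thm. 7.31]
[cite: Fulton1998, Lemma 19.1.2] -/
theorem genericDivisibilityBounded_exists_sub_map_mem_supportedClasses_of_isBirational
    (hX' : IsSmoothProjective n X') (hX : IsSmoothProjective n X) (σ : X' ⟶ X)
    (hσ : Literature.AlgebraicGeometry.Resolution.IsBirational σ.left) {k q : ℕ}
    (h : k + q = 2 * n) (x' : complexBetti X' k) :
    ∃ y : complexBetti X k, x' - complexBetti.map σ k y ∈ supportedClasses X' k 1 := by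
  letI := hX.chartedSpace
  letI := hX'.chartedSpace
  haveI := ComplexPoints.compactSpace_of_isSmoothProjective hX
  haveI := ComplexPoints.compactSpace_of_isSmoothProjective hX'
  haveI := ComplexPoints.t2Space_of_isSmoothProjective hX
  haveI := ComplexPoints.t2Space_of_isSmoothProjective hX'
  haveI : IsIntegral X'.left := IsSmoothProjective.isIntegral_holds hX'
  have hσ' := hσ
  obtain ⟨U, -, hU', hiso⟩ := hσ'
  haveI : IsIso (σ.left ∣_ U) := hiso
  set f : C(ComplexPoints X', ComplexPoints X) := AlgPoints.mapContinuous (L := ℂ) σ with hf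
  -- complex orientations of degree one, and the complex Gysin map `G = σ_!`
  obtain ⟨μ, ν, hdeg⟩ := exists_hasDegree_one_of_isBirational hX' hX σ hσ
  have hνPD : ν.HasPoincareDuality := fun _ _ h' ↦ poincare_duality ν h'
  set G := gysinMap μ ν f h h with hG
  set y : complexBetti X k := G x' with hy
  set w : complexBetti X' k := x' - complexBetti.map σ k y with hw
  -- `σ_! w = σ_! x' - σ_! σ^* σ_! x' = 0`
  have hGw : G w = 0 := by
    rw [hw, map_sub]
    change G x' - gysinMap μ ν f h h (singularCohomology.map ℂ ℂ f k y) = 0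
    rw [gysinMap_map_of_hasDegree hνPD hdeg h, one_smul, hy, sub_self]
  -- so `w` dies on `(σ⁻¹U)(ℂ)`, a non-empty open of the integral `X'`
  have hA := genericDivisibilityBounded_restrictCompl_eq_zero_of_gysinMap_eq_zero hX' hX σ hσ U μ ν
    hdeg h w hGw
  have hE : IsClosed (σ.left.base ⁻¹' (U : Set X.left)ᶜ) :=
    U.2.isClosed_compl.preimage σ.left.continuous
  have hEne : σ.left.base ⁻¹' (U : Set X.left)ᶜ ≠ Set.univ := by
    obtain ⟨x, hx⟩ := hU'.nonempty
    exact fun hu ↦ (hu ▸ Set.mem_univ x : x ∈ σ.left.base ⁻¹' (U : Set X.left)ᶜ) hx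
  exact ⟨y, mem_supportedClasses_of_restrictCompl_eq_zero hE
    ((forall_one_le_coheight_iff_ne_univ hE).2 hEne) hA⟩

/-! ### `N¹ = ⊤` ascends along birational morphisms -/

/-- **`N¹H^k = H^k` ascends along birational morphisms of smooth projective varieties.** Let
`σ : X' ⟶ X` be a `ℂ`-morphism of smooth projective `n`-folds with `σ.left` birational and
`k + q = 2n`. If `supportedClasses X k 1 = ⊤` then `supportedClasses X' k 1 = ⊤`: every `x'` on
`X'` is `w + σ^* y` with `w ∈ N¹H^k(X')`
(`genericDivisibilityBounded_exists_sub_map_mem_supportedClasses_of_isBirational`), and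
`σ^* y ∈ N¹H^k(X')` since `y ∈ N¹H^k(X) = H^k(X)` and pull-back along the surjective (proper
birational, `surjective_base_of_isBirational`) `σ` preserves `N¹`
(`map_mem_supportedClasses_one_of_surjective`: a class dying off a proper closed `S ⊆ X` pulls back
to one dying off the proper closed `σ⁻¹S`).
[cite: VoisinHodgeI2002, §7.3.2 Lemma 7.28 and proof of Thm. 7.31]
[cite: GrothendieckTopology1969, §1] -/
theorem genericDivisibilityBounded_supportedClasses_eq_top_of_isBirational_up
    (hX' : IsSmoothProjective n X') (hX : IsSmoothProjective n X) (σ : X' ⟶ X)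
    (hσ : Literature.AlgebraicGeometry.Resolution.IsBirational σ.left) {k q : ℕ}
    (h : k + q = 2 * n) (htop : supportedClasses X k 1 = ⊤) : supportedClasses X' k 1 = ⊤ := by
  haveI : IsProper σ.left := isProper_left_of_isSmoothProjective hX' hX σ
  have hsurj : Function.Surjective σ.left.base := surjective_base_of_isBirational σ.left hσ
  refine eq_top_iff.2 fun x' _ ↦ ?_
  obtain ⟨y, hw⟩ :=
    genericDivisibilityBounded_exists_sub_map_mem_supportedClasses_of_isBirational hX' hX σ hσ h x'
  have hy : complexBetti.map σ k y ∈ supportedClasses X' k 1 :=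
    map_mem_supportedClasses_one_of_surjective hX' hX σ hsurj (htop ▸ Submodule.mem_top)
  rw [← sub_add_cancel x' (complexBetti.map σ k y)]
  exact Submodule.add_mem _ hw hy

/-- **`N¹H^k = H^k` is a birational invariant of smooth projective varieties.** For `σ : X' ⟶ X`
birational between smooth projective `n`-folds and `k + q = 2n`:
`supportedClasses X' k 1 = ⊤ ↔ supportedClasses X k 1 = ⊤` (descent along the surjective `σ`:
the landed `genericDivisibilityBounded_supportedClasses_eq_top_of_surjective`, Voisin I
Remark 7.29 `σ_* σ^* = deg σ • id`; ascent:
`genericDivisibilityBounded_supportedClasses_eq_top_of_isBirational_up`).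
[cite: VoisinHodgeI2002, §7.3.2 Lemma 7.28, Remark 7.29 and proof of Thm. 7.31] -/
theorem genericDivisibilityBounded_supportedClasses_eq_top_iff_of_isBirational
    (hX' : IsSmoothProjective n X') (hX : IsSmoothProjective n X) (σ : X' ⟶ X)
    (hσ : Literature.AlgebraicGeometry.Resolution.IsBirational σ.left) {k q : ℕ}
    (h : k + q = 2 * n) : supportedClasses X' k 1 = ⊤ ↔ supportedClasses X k 1 = ⊤ := by
  haveI : IsProper σ.left := isProper_left_of_isSmoothProjective hX' hX σ
  exact ⟨genericDivisibilityBounded_supportedClasses_eq_top_of_surjective hX' hX σ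
      (surjective_base_of_isBirational σ.left hσ),
    genericDivisibilityBounded_supportedClasses_eq_top_of_isBirational_up hX' hX σ hσ h⟩

/-! ### The registered sub-goal -/

/-- **Registered sub-goal `stub_supportedTopOfBirationalUp` of stmt-HodgeConjecture-18467 (lead c5,
line `finite-level-bootstrap`): the `N¹ = ⊤` sector ASCENDS along birational morphisms of smooth
projective `n`-folds** — for `σ : X' ⟶ X` birational, `k ≥ 1`, `k + q = 2n`,
`supportedClasses X k 1 = ⊤` implies `supportedClasses X' k 1 = ⊤`; with the landed descent
(`genericDivisibilityBounded_supportedClasses_eq_top_of_surjective`) the sector where C2 and the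
heart are theorems is a birational invariant. Proof:
`genericDivisibilityBounded_supportedClasses_eq_top_of_isBirational_up` (the hypothesis `1 ≤ k`
is not used). [cite: VoisinHodgeI2002, §7.3.2 Lemma 7.28 and proof of Thm. 7.31]
[cite: Fulton1998, Lemma 19.1.2] -/
theorem stub_supportedTopOfBirationalUp :
    ∀ ⦃n : ℕ⦄ ⦃X' X : SchemeOver ℂ⦄ (σ : X' ⟶ X), IsSmoothProjective n X' → IsSmoothProjective n X →
      Literature.AlgebraicGeometry.Resolution.IsBirational σ.left →
      ∀ k q : ℕ, 1 ≤ k → k + q = 2 * n → supportedClasses X k 1 = ⊤ → supportedClasses X' k 1 = ⊤ :=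
  fun _ _ _ σ hX' hX hσ _ _ _ h htop ↦
    genericDivisibilityBounded_supportedClasses_eq_top_of_isBirational_up hX' hX σ hσ h htop

end Summit.HodgeConjecture.HodgeConjecture.Theorems

end
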